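import Mathlib
import Summits.ResolutionOfSingularities.ResolutionOfSingularities.Theorems.WeightedInvariantLocalWeightedDropNCBlocks

/-!
# `LocalWeightedDrop`, line `nc-game-transport`, TOT rung R5 (part 2/2): **PRODUCT CLOSURE** — finite-round NC-winnability is
# multiplicative over disjoint blocks of variables, with additive round count

[OURS · L1 W4.3 · chain w43, engine crux `LocalWeightedDrop` stmt-ResolutionOfSingularities-8899; strategist res-L1-w43-strat-1, line
`nc-game-transport`, rung spec `TOT-RUNGS-SPEC.md` v2 §R5 (typed `NCTransport.Census.ProductClosure`, proof sketch by the strategist, checked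
against `IsCountMove/MoveClause/WinsIn`, `CobordantChart.chart`, `TupleGame.slice`); res-L1-w43-plan-1 RULING gen 9 #5 (3) to res-D-pv-006.
Objects = the programme's own count game; NOT a statement of any manuscript; closes nothing by name — a STRUCTURAL rung: with rung R0
(…NCSmoothPower) and the plane count (⟨F-32bR⟩ ⇒ `HTOT 2`) it yields sorry-free `HTOT`-instances in every dimension (products of plane curve
germs in disjoint variables, …); it removes exactly the DECOMPOSABLE germs from the residual `HTOT m`, `m ≥ 3` (STRATEGY-CENSUS v1.2 (D-b)).]

THE PLAY (strategist's design; only LEFT rounds are ever played).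
* `isCountMove_blockExtend` — `b₁`'s move `(Φ₁, w₁)` extends to `(Φ₁ ⊗ id, w₁ ⊕ 0)`; `subst_chart_blockExtend` — at an exceptional point `c`
  (necessarily `0` on the weight-`0` right block) the transform of `(b₁ on the left) · (b₂ on the right)` is `s^{A₁} · (G₁ on the shifted left
  block) · (b₂ on the shifted right block)` for ANY expression `s^{A₁} G₁` of the left transform.
* `winsIn_mul_disjoint_left` — PHASE 1, induction on `n₁` with `b₂` riding along: given the opponent's factorisation `s^A G`, `s ∤ G`, the
  uniqueness of the `s`-saturation (`saturation_unit_mul`; `s ∤ (G₁ on the left)·(b₂ on the right)` by `killCompl`) gives `A = A₁`,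
  `G = (G₁)·(b₂)`; `b₁`'s clause picks a live LEFT slot `i₁`, and the new position `s · G|_{y_{i₁} = 0}` is LITERALLY
  `(b₁'s new position on the left block) · (b₂ on the right block)` (`slice_bL_rename_bL/bR`) — same blocks, so the induction hypothesis applies.
* `germIsNC_mul_disjoint` — TERMINAL: normal crossings multiply over disjoint blocks (block-diagonal normalising coordinates `Φ₁ ⊗ Φ₂`,
  `det = det Φ₁ · det Φ₂`).
* `winsIn_mul_disjoint_right` — PHASE 2 = phase 1 in the SWAPPED blocks (`swap_hM`) with `N = 0` and the terminal lemma, transported back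
  along the block-swap permutation (`subst_blockSwap_mul`; `isUnit_det_linMat_perm`: a permutation of the variables is a legal coordinate
  change, its linear part being a permutation matrix; `winsIn_germIsNC_of_subst`).
* `winsIn_germIsNC_mul_blocks` (block form) and **`winsIn_germIsNC_mul_disjoint`** = `ProductClosure m₁ m₂` with the census body VERBATIM
  (`rename_eq_subst`): `b₁ ≠ 0 → b₂ ≠ 0 → WinsIn n₁ b₁ → WinsIn n₂ b₂ → WinsIn (n₁ + n₂) (embL b₁ · embR b₂)` in `m₁ + m₂ + 2` variables;
  `exists_winsIn_germIsNC_mul_disjoint` (the TOT shape `∃ n, WinsIn GermIsNC n ·`).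
-/

noncomputable section

open Literature.AlgebraicGeometry.Resolution

set_option linter.dupNamespace false -- mandated namespace of this single-conjunct summit

namespace Summit.ResolutionOfSingularities.ResolutionOfSingularities.Theorems

namespace NCTransport

open MvPowerSeries TameFourTupleDrop

variable {k : Type} [Field k]

section Blocks

variable {m₁ m₂ M : ℕ} (hM : m₁ + m₂ + 1 = M)

/-! ### Permutations of the variables; the block swap on a product -/

/-- A permutation of the variables is a legal coordinate change: its linear part is a permutation matrix. -/
theorem isUnit_det_linMat_perm {n : ℕ} (π : Equiv.Perm (Fin n)) :
    IsUnit (Matrix.det (Matrix.of fun l j => coeff (Finsupp.single j 1) ((X ∘ π) l : MvPowerSeries (Fin n) k))) := by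
  have h : (Matrix.of fun l j => coeff (Finsupp.single j 1) ((X ∘ π) l : MvPowerSeries (Fin n) k)) = π.permMatrix k := by
    ext l j
    rw [Matrix.of_apply, Function.comp_apply, coeff_X, Equiv.Perm.permMatrix, PEquiv.toMatrix_toPEquiv_apply, Pi.single_apply]
    by_cases hj : j = π l
    · subst hj; rw [if_pos rfl, if_pos rfl]
    · rw [if_neg (fun h => hj (Finsupp.single_left_injective one_ne_zero h)), if_neg hj]
  rw [h, Matrix.det_permutation]
  rcases Int.units_eq_one_or (Equiv.Perm.sign π) with hs | hs <;> simp [hs]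

/-- Renaming a product in disjoint blocks along the block swap exchanges the roles of the blocks. -/
theorem subst_blockSwap_mul (b₁ : MvPowerSeries (Fin (m₁ + 1)) k) (b₂ : MvPowerSeries (Fin (m₂ + 1)) k) :
    subst (X ∘ ⇑(blockSwap hM)) (rename (bL hM) b₁ * rename (bR hM) b₂) =
      rename (bL (swap_hM hM)) b₂ * rename (bR (swap_hM hM)) b₁ := by
  have hs : HasSubst (X ∘ ⇑(blockSwap hM) : Fin (M + 1) → MvPowerSeries (Fin (M + 1)) k) := HasSubst.X_comp _
  rw [← coe_substAlgHom hs, map_mul, coe_substAlgHom, subst_rename_eq _ hs, subst_rename_eq _ hs, Function.comp_assoc,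
    Function.comp_assoc, blockSwap_comp_bL, blockSwap_comp_bR, ← rename_eq_subst, ← rename_eq_subst, mul_comm]

/-! ## The game on a product of germs in disjoint blocks of variables -/

/-- BLOCK EXTENSION OF A MOVE (OURS · L1 W4.3, rung R5): a count-game move `(Φ₁, w₁)` on the left block extends to the move
`(Φ₁ ⊗ id, w₁ ⊕ 0)` of the big game (weights `0` on the right block). -/
theorem isCountMove_blockExtend {Φ₁ : Fin (m₁ + 1) → MvPowerSeries (Fin (m₁ + 1)) k} {w₁ : Fin (m₁ + 1) → ℕ}
    (hmv : IsCountMove Φ₁ w₁) : IsCountMove (m := M) (blockSubst hM Φ₁ X) (blockFun hM w₁ 0) := by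
  obtain ⟨hΦ0, hdet, hw1, i₀, hi₀⟩ := hmv
  refine ⟨constantCoeff_blockSubst hM hΦ0 (fun j => constantCoeff_X j), ?_, fun l => ?_, ⟨bL hM i₀, by rw [blockFun_bL]; exact hi₀⟩⟩
  · rw [det_linMat_blockSubst]
    exact hdet.mul (isUnit_det_linMat_perm (Equiv.refl _))
  · rcases block_cases hM l with ⟨i, rfl⟩ | ⟨j, rfl⟩
    · rw [blockFun_bL]; exact hw1 i
    · rw [blockFun_bR]; exact Nat.zero_le _

/-- THE TRANSFORM OF A PRODUCT IN DISJOINT BLOCKS under the extended move and a chart at an exceptional point `c` (vanishing on the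
right block, restriction `c₁` to the left block): `s^{A₁} · (G₁ on the shifted left block) · (b₂ on the shifted right block)`, where
`s^{A₁} G₁` is ANY expression of the left transform. -/
theorem subst_chart_blockExtend {Φ₁ : Fin (m₁ + 1) → MvPowerSeries (Fin (m₁ + 1)) k} (hΦ0 : ∀ i, constantCoeff (Φ₁ i) = 0)
    {w₁ : Fin (m₁ + 1) → ℕ} {c : Fin (M + 1) → k} (hc : ∀ l, blockFun hM w₁ 0 l = 0 → c l = 0)
    (b₁ : MvPowerSeries (Fin (m₁ + 1)) k) (b₂ : MvPowerSeries (Fin (m₂ + 1)) k) {A₁ : ℕ} {G₁ : MvPowerSeries (Fin (m₁ + 1 + 1)) k}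
    (hfac₁ : subst (CobordantChart.chart w₁ (fun i => c (bL hM i))) (subst Φ₁ b₁) = X 0 ^ A₁ * G₁) :
    subst (CobordantChart.chart (blockFun hM w₁ 0) c) (subst (blockSubst hM Φ₁ X) (rename (bL hM) b₁ * rename (bR hM) b₂)) =
      X 0 ^ A₁ * (rename (bL (succ_hM hM)) G₁ * rename (bR (succ_hM hM)) b₂) := by
  have hX0 : ∀ j : Fin (m₂ + 1), constantCoeff (X j : MvPowerSeries (Fin (m₂ + 1)) k) = 0 := fun j => constantCoeff_X j
  have hΦs := hasSubst_blockSubst hM hΦ0 hX0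
  have hch := CobordantChart.hasSubst_chart _ c hc
  have hwR : ∀ j, blockFun hM w₁ 0 (bR hM j) = 0 := fun j => by rw [blockFun_bR]; rfl
  rw [← coe_substAlgHom hΦs, ← coe_substAlgHom hch, map_mul, map_mul, coe_substAlgHom hΦs, coe_substAlgHom hch,
    subst_blockSubst_rename_bL hM hΦ0 hX0, subst_blockSubst_rename_bR hM hΦ0 hX0, subst_self,
    subst_chart_rename_bL hM hc (blockFun_bL hM w₁ 0) (fun i => rfl), subst_chart_rename_bR hM hc hwR, hfac₁, map_mul, map_pow,
    rename_bL_X_zero hM]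
  exact (mul_assoc _ _ _).trans rfl

/-- NORMAL CROSSINGS MULTIPLY OVER DISJOINT BLOCKS (OURS · L1 W4.3, rung R5, terminal positions): if `b₁` and `b₂` have normal-crossing
support then so has `(b₁ on the left block) · (b₂ on the right block)` — block-diagonal normalising coordinates. -/
theorem germIsNC_mul_disjoint {b₁ : MvPowerSeries (Fin (m₁ + 1)) k} {b₂ : MvPowerSeries (Fin (m₂ + 1)) k}
    (h₁ : GermIsNC b₁) (h₂ : GermIsNC b₂) : GermIsNC (rename (bL hM) b₁ * rename (bR hM) b₂) := by
  obtain ⟨Φ₁, u₁, e₁, hΦ₁0, hΦ₁det, hu₁, heq₁⟩ := h₁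
  obtain ⟨Φ₂, u₂, e₂, hΦ₂0, hΦ₂det, hu₂, heq₂⟩ := h₂
  have hΦs := hasSubst_blockSubst hM hΦ₁0 hΦ₂0
  refine ⟨blockSubst hM Φ₁ Φ₂, rename (bL hM) u₁ * rename (bR hM) u₂, blockFun hM e₁ e₂, constantCoeff_blockSubst hM hΦ₁0 hΦ₂0,
    ?_, ?_, ?_⟩
  · rw [det_linMat_blockSubst]
    exact hΦ₁det.mul hΦ₂det
  · rw [map_mul, constantCoeff_rename, constantCoeff_rename]
    exact mul_ne_zero hu₁ hu₂
  · rw [← coe_substAlgHom hΦs, map_mul, coe_substAlgHom, subst_blockSubst_rename_bL hM hΦ₁0 hΦ₂0,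
      subst_blockSubst_rename_bR hM hΦ₁0 hΦ₂0, heq₁, heq₂, map_mul, map_mul, map_prod, map_prod,
      prod_block hM (fun l => X l ^ blockFun hM e₁ e₂ l)]
    simp only [map_pow, rename_X, blockFun_bL, blockFun_bR]
    ring

/-- PHASE 1 (OURS · L1 W4.3, rung R5): play `b₁`'s winning strategy on the left block while `b₂` rides along unchanged on the right
block.  If every product `(NC germ on the left) · b₂` is won within `N` rounds, then `(b₁ on the left) · b₂` is won within `n₁ + N`
rounds whenever `b₁` is won within `n₁`. -/
theorem winsIn_mul_disjoint_left {b₂ : MvPowerSeries (Fin (m₂ + 1)) k} (hb₂ : b₂ ≠ 0) {N : ℕ}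
    (hN : ∀ b₁ : MvPowerSeries (Fin (m₁ + 1)) k, b₁ ≠ 0 → GermIsNC b₁ →
      WinsIn (m := M) GermIsNC N (rename (bL hM) b₁ * rename (bR hM) b₂)) :
    ∀ (n₁ : ℕ) (b₁ : MvPowerSeries (Fin (m₁ + 1)) k), b₁ ≠ 0 → WinsIn GermIsNC n₁ b₁ →
      WinsIn (m := M) GermIsNC (n₁ + N) (rename (bL hM) b₁ * rename (bR hM) b₂) := by
  intro n₁
  induction n₁ with
  | zero =>
    intro b₁ hb₁ h
    rw [Nat.zero_add]
    exact hN b₁ hb₁ h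
  | succ n₁ ih =>
    intro b₁ hb₁ h
    rw [Nat.add_right_comm]
    rcases h with h | ⟨Φ₁, w₁, hmv, hcl⟩
    · exact Or.inl (ih b₁ hb₁ h)
    refine winsIn_move (isCountMove_blockExtend hM hmv) fun c hc hc0 A G hfac hG => ?_
    obtain ⟨hΦ0, hdet, hw1, -⟩ := hmv
    -- the exceptional point restricted to the left block
    have hcR : ∀ j, c (bR hM j) = 0 := fun j => hc _ (by rw [blockFun_bR]; rfl)
    have hc₁ : ∀ i, w₁ i = 0 → c (bL hM i) = 0 := fun i hi => hc _ (by rw [blockFun_bL]; exact hi)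
    have hc₁0 : (fun i => c (bL hM i)) ≠ 0 := by
      intro h0
      apply hc0
      funext l
      rcases block_cases hM l with ⟨i, rfl⟩ | ⟨j, rfl⟩
      · exact congr_fun h0 i
      · exact hcR j
    -- the left transform and its `s`-saturation
    have hT₁ : subst (CobordantChart.chart w₁ fun i => c (bL hM i)) (subst Φ₁ b₁) ≠ 0 :=
      CobordantChart.subst_chart_ne_zero w₁ _ hc₁ (FormalCoordChange.subst_ne_zero_of_isUnit_det hΦ0 hdet hb₁)
    obtain ⟨A₁, G₁, hfac₁, hG₁⟩ := CobordantVertexChart.exists_eq_X_pow_mul_not_dvd hT₁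
    have hprod := subst_chart_blockExtend hM hΦ0 hc b₁ b₂ hfac₁
    -- uniqueness of the `s`-saturation: `A = A₁`, `G = (G₁ on the left) · (b₂ on the right)`
    have hGG : ¬ X 0 ∣ rename (bL (succ_hM hM)) G₁ * rename (bR (succ_hM hM)) b₂ := fun h =>
      ((MvPowerSeries.prime_X' k (0 : Fin (M + 1 + 1))).dvd_or_dvd h).elim
        (fun h1 => hG₁ (X_dvd_of_X_dvd_rename_bL hM h1)) (fun h2 => hb₂ (eq_zero_of_X_dvd_rename_bR hM h2))
    have hsat : (1 : MvPowerSeries (Fin (M + 1 + 1)) k) * (X 0 ^ A₁ * (rename (bL (succ_hM hM)) G₁ * rename (bR (succ_hM hM)) b₂)) =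
        X 0 ^ A * G := by rw [one_mul, ← hprod, hfac]
    obtain ⟨-, hGeq⟩ := saturation_unit_mul (by rw [map_one]; exact one_ne_zero) hGG hG hsat
    -- `b₁`'s clause picks the live (left) slot
    obtain ⟨i₁, hci₁, hwin₁⟩ := hcl (fun i => c (bL hM i)) hc₁ hc₁0 A₁ G₁ hfac₁ hG₁
    refine ⟨bL hM i₁, hci₁, ?_⟩
    have hpos : X 0 * TupleGame.slice (bL hM i₁) G =
        rename (bL hM) (X 0 * TupleGame.slice i₁ G₁) * rename (bR hM) b₂ := by
      rw [hGeq, one_mul, slice_mul, slice_bL_rename_bL hM, slice_bL_rename_bR hM, map_mul, rename_X, bL_zero, mul_assoc]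
    rw [hpos]
    have hne : X 0 * TupleGame.slice i₁ G₁ ≠ 0 :=
      mul_ne_zero (MvPowerSeries.prime_X' k (0 : Fin (m₁ + 1))).ne_zero
        (TupleDropAssembly.slice_ne_zero (subst Φ₁ b₁) w₁ _ hc₁ hw1 A₁ G₁ hfac₁ hG₁ i₁ hci₁)
    exact ih _ hne hwin₁

/-- PHASE 2 (OURS · L1 W4.3, rung R5): with `b₁` already a normal crossing on the left block, play `b₂`'s strategy on the right block —
realised as PHASE 1 in the swapped blocks (so that only left rounds are ever played), transported back along the block swap. -/
theorem winsIn_mul_disjoint_right {b₁ : MvPowerSeries (Fin (m₁ + 1)) k} (hb₁ : b₁ ≠ 0) (hnc₁ : GermIsNC b₁)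
    (n₂ : ℕ) {b₂ : MvPowerSeries (Fin (m₂ + 1)) k} (hb₂ : b₂ ≠ 0) (h₂ : WinsIn GermIsNC n₂ b₂) :
    WinsIn (m := M) GermIsNC n₂ (rename (bL hM) b₁ * rename (bR hM) b₂) := by
  have hA := winsIn_mul_disjoint_left (swap_hM hM) hb₁ (N := 0)
    (fun b₂' _ hnc₂' => (winsIn_zero _ _).mpr (germIsNC_mul_disjoint (swap_hM hM) hnc₂' hnc₁)) n₂ b₂ hb₂ h₂
  rw [Nat.add_zero n₂, ← subst_blockSwap_mul hM] at hA
  exact winsIn_germIsNC_of_subst (fun l => constantCoeff_X _) (isUnit_det_linMat_perm (blockSwap hM)) n₂ _ hA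

/-- **PRODUCT CLOSURE OF FINITE-ROUND NC-WINNABILITY** (OURS · L1 W4.3, line `nc-game-transport`, TOT rung R5; block form): if the
mover forces normal-crossing support from `b₁ ≠ 0` (in `m₁ + 1` variables) within `n₁` rounds and from `b₂ ≠ 0` (in `m₂ + 1` variables)
within `n₂` rounds, then from `(b₁ on the left block) · (b₂ on the right block)` in `M + 1 = (m₁ + 1) + (m₂ + 1)` variables within
`n₁ + n₂` rounds: phase 1 then phase 2. -/
theorem winsIn_germIsNC_mul_blocks {b₁ : MvPowerSeries (Fin (m₁ + 1)) k} {b₂ : MvPowerSeries (Fin (m₂ + 1)) k} (hb₁ : b₁ ≠ 0)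
    (hb₂ : b₂ ≠ 0) {n₁ n₂ : ℕ} (h₁ : WinsIn GermIsNC n₁ b₁) (h₂ : WinsIn GermIsNC n₂ b₂) :
    WinsIn (m := M) GermIsNC (n₁ + n₂) (rename (bL hM) b₁ * rename (bR hM) b₂) :=
  winsIn_mul_disjoint_left hM hb₂ (fun _ hb₁' hnc => winsIn_mul_disjoint_right hM hb₁' hnc n₂ hb₂ h₂) n₁ b₁ hb₁ h₁

end Blocks

/-- **PRODUCT CLOSURE** `ProductClosure m₁ m₂` in the census spelling (OURS · L1 W4.3, line `nc-game-transport`, TOT rung R5 =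
`NCTransport.Census.ProductClosure` of res-L1-w43-strat-1's `census_sketch.lean`, body VERBATIM): finite-round NC-winnability is
multiplicative over disjoint variable blocks, with additive round count — for the block embeddings `xᵢ ↦ xᵢ` and `xⱼ ↦ x_{m₁+1+j}` written
as substitutions. -/
theorem winsIn_germIsNC_mul_disjoint (m₁ m₂ : ℕ) (b₁ : MvPowerSeries (Fin (m₁ + 1)) k) (b₂ : MvPowerSeries (Fin (m₂ + 1)) k)
    (n₁ n₂ : ℕ) (hb₁ : b₁ ≠ 0) (hb₂ : b₂ ≠ 0) (h₁ : WinsIn (m := m₁) GermIsNC n₁ b₁) (h₂ : WinsIn (m := m₂) GermIsNC n₂ b₂) :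
    WinsIn (m := m₁ + m₂ + 1) GermIsNC (n₁ + n₂)
      (MvPowerSeries.subst (fun i : Fin (m₁ + 1) => (X ⟨i.val, by omega⟩ : MvPowerSeries (Fin (m₁ + m₂ + 1 + 1)) k)) b₁ *
        MvPowerSeries.subst (fun j : Fin (m₂ + 1) => (X ⟨m₁ + 1 + j.val, by omega⟩ : MvPowerSeries (Fin (m₁ + m₂ + 1 + 1)) k)) b₂) := by
  have h := winsIn_germIsNC_mul_blocks (rfl : m₁ + m₂ + 1 = m₁ + m₂ + 1) hb₁ hb₂ h₁ h₂
  rw [rename_eq_subst, rename_eq_subst] at h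
  exact h

/-- The rung in the TOT shape: a product of finitely winnable germs in disjoint blocks is finitely winnable. -/
theorem exists_winsIn_germIsNC_mul_disjoint (m₁ m₂ : ℕ) {b₁ : MvPowerSeries (Fin (m₁ + 1)) k} {b₂ : MvPowerSeries (Fin (m₂ + 1)) k}
    (hb₁ : b₁ ≠ 0) (hb₂ : b₂ ≠ 0) (h₁ : ∃ n, WinsIn (m := m₁) GermIsNC n b₁) (h₂ : ∃ n, WinsIn (m := m₂) GermIsNC n b₂) :
    ∃ n, WinsIn (m := m₁ + m₂ + 1) GermIsNC n
      (MvPowerSeries.subst (fun i : Fin (m₁ + 1) => (X ⟨i.val, by omega⟩ : MvPowerSeries (Fin (m₁ + m₂ + 1 + 1)) k)) b₁ *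
        MvPowerSeries.subst (fun j : Fin (m₂ + 1) => (X ⟨m₁ + 1 + j.val, by omega⟩ : MvPowerSeries (Fin (m₁ + m₂ + 1 + 1)) k)) b₂) := by
  obtain ⟨n₁, h₁⟩ := h₁
  obtain ⟨n₂, h₂⟩ := h₂
  exact ⟨n₁ + n₂, winsIn_germIsNC_mul_disjoint m₁ m₂ b₁ b₂ n₁ n₂ hb₁ hb₂ h₁ h₂⟩

end NCTransport

end Summit.ResolutionOfSingularities.ResolutionOfSingularities.Theorems
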